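import Mathlib

/-!
# PartN30 — PORT SPEC N30-A: the three-magnon K-fibre model and the Krein objects (statements only)

Configuration space of three hard-core bosons (magnons of the ferromagnetic-side XXZ model) on the
`L × L` torus in the fibre of total lattice momentum `K`: relative coordinates `c = (a, b)`,
`a = x₂ − x₁`, `b = x₃ − x₁`, wave function `Ψ(x₁,x₂,x₃) = e^{iK·x₁} F(a,b)`.

* `H0apply K F`  — free hopping (magnon dispersion `ε(k) = 2 − cos kₓ − cos k_y`, amplitude ½),
* `Happly K Δ F` — with the nearest-neighbour attraction `−Δ·W`, `W(a,b)` = number of n.n. pairs,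
* hard core = Dirichlet condition on `D = {a = 0} ∪ {b = 0} ∪ {a = b}`, contact shell `S = Dᶜ ∩ {W ≥ 1}`,
* bosonic symmetry = invariance under the two transpositions `U23`, `U12` (with the `K`-phase),
* `GM3Fibre L Δ` : the three-magnon rung of CONJECTURE GM in fibre language:
     `min RQ over the K₁-sector − ε₁ ≥ min RQ over the K = 0 sector`,
* the Krein objects of memo ROTOR-THEORY-20 §277: pole-removed free resolvent kernel `Gentry`,
  the block matrix `Nmat T Δ` on `D ⊕ S`, the pole state `vpole`, `Phi T Δ = ⟨v, 𝒩⁻¹ v⟩ / 3V²`,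
  and the statements `KreinThree` (eigenvalue ⟺ fixed point) and `CertLogic`
  (Φ(T) > T on (0,T*] & a K=0 trial with RQ ≤ T* & no K₁ level at or below ε₁ ⟹ GM3Fibre).

Everything here is a definition or a `Prop`; proofs are the prover's (port N30-A), the unitary
equivalence with the 3-magnon sector of `xxzHamiltonian 1 (torusGraph 2 L) (-1) Δ` is port N30-B.
-/

-- Port of theory seat `hubbard-h0-rotor-theory-1` cycle20/lean/PartN30.lean (PORT SPEC N30-A statement file) verbatim modulo this header,
-- `set_option linter.dupNamespace false` and lint fixes; prover seat `hubbard-h0-rotor-p1` g21, `--supports stmt-HubbardSuperconductivity-19089`.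

set_option linter.dupNamespace false

open scoped BigOperators
open Complex

namespace Summit.HubbardSuperconductivity.HubbardSuperconductivity.Theorems.AnisotropyChord.Transfer.Fibre3

/-- A site / momentum of the `L × L` torus. -/
abbrev Tor (L : ℕ) := ZMod L × ZMod L
/-- A relative configuration `(a, b)` of three particles. -/
abbrev Cfg (L : ℕ) := Tor L × Tor L

variable (L : ℕ) [NeZero L]

/-- The four nearest-neighbour vectors. -/
def nnList : List (Tor L) := [((1 : ZMod L), 0), (-1, 0), (0, 1), (0, -1)]

/-- `r` is a nearest-neighbour vector (Boolean, so that no `instance` is needed downstream). -/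
def IsNN (r : Tor L) : Bool :=
  decide (r = ((1 : ZMod L), 0)) || decide (r = (-1, 0)) || decide (r = (0, 1)) || decide (r = (0, -1))

/-- Number of nearest-neighbour pairs among the three particles in configuration `(a,b)`. -/
def Wcount (c : Cfg L) : ℕ :=
  (if IsNN L c.1 then 1 else 0) + (if IsNN L c.2 then 1 else 0) + (if IsNN L (c.2 - c.1) then 1 else 0)

/-- Hard-core set `D`: two particles coincide (Boolean). -/
def InD (c : Cfg L) : Bool := decide (c.1 = 0) || decide (c.2 = 0) || decide (c.1 = c.2)

/-- Contact shell `S`: off the hard core, at least one nearest-neighbour pair (Boolean). -/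
def InS (c : Cfg L) : Bool := !(InD L c) && decide (1 ≤ Wcount L c)

/-- The phase `e^{i K·r}` with `K, r` read through `ZMod.val` (well defined by periodicity of `exp`). -/
noncomputable def phase (K r : Tor L) : ℂ :=
  Complex.exp (2 * Real.pi * Complex.I * (((K.1.val * r.1.val + K.2.val * r.2.val : ℕ) : ℂ) / (L : ℂ)))

/-- Free three-body hopping in the `K` fibre: `6F − ½ Σ_e [F(a+e,b) + F(a,b+e) + e^{iK·e} F(a−e,b−e)]`. -/
noncomputable def H0apply (K : Tor L) (F : Cfg L → ℂ) : Cfg L → ℂ := fun c =>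
  6 * F c - (1 / 2 : ℂ) *
    ((nnList L).map (fun e => F (c.1 + e, c.2) + F (c.1, c.2 + e) + phase L K e * F (c.1 - e, c.2 - e))).sum

/-- The fibre Hamiltonian with the nearest-neighbour attraction `−Δ W`. -/
noncomputable def Happly (K : Tor L) (Δ : ℝ) (F : Cfg L → ℂ) : Cfg L → ℂ := fun c =>
  H0apply L K F c - (Δ : ℂ) * (Wcount L c : ℂ) * F c

/-- Bosonic symmetry in fibre coordinates: invariance under `2 ↔ 3` and under `1 ↔ 2`
(`F ↦ e^{iK·a} F(−a, b−a)`); the two transpositions generate `S₃`. -/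
def IsSymm (K : Tor L) (F : Cfg L → ℂ) : Prop :=
  (∀ c : Cfg L, F (c.2, c.1) = F c) ∧ (∀ c : Cfg L, phase L K c.1 * F (-c.1, c.2 - c.1) = F c)

/-- Admissible trial functions of the `K` sector: symmetric, vanishing on the hard core, nonzero. -/
def Admissible (K : Tor L) (F : Cfg L → ℂ) : Prop :=
  IsSymm L K F ∧ (∀ c, InD L c = true → F c = 0) ∧ F ≠ 0

/-- `ℓ²` inner product on the fibre. -/
noncomputable def ip (F G : Cfg L → ℂ) : ℂ := ∑ c : Cfg L, (starRingEnd ℂ) (F c) * G c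

/-- Rayleigh quotient of `Happly K Δ`. -/
noncomputable def RQ (K : Tor L) (Δ : ℝ) (F : Cfg L → ℂ) : ℝ :=
  (ip L F (Happly L K Δ F)).re / (ip L F F).re

/-- One-magnon energy at the smallest momentum, `ε₁ = 1 − cos(2π/L)`. -/
noncomputable def eps1 : ℝ := 1 - Real.cos (2 * Real.pi / L)

/-- The smallest nonzero momentum `K₁ = (1, 0)`. -/
def K1 : Tor L := ((1 : ZMod L), 0)

/-- GM₃ in fibre language: the `K₁` three-magnon gap above the one-magnon branch dominates the
`K = 0` three-magnon gap: `min_F RQ_{K₁}(F) − ε₁ ≥ min_G RQ₀(G)` (minima over admissible functions;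
stated as: every `K₁` value is matched from below by some `K = 0` value). -/
def GM3Fibre (Δ : ℝ) : Prop :=
  ∀ F : Cfg L → ℂ, Admissible L (K1 L) F →
    ∃ G : Cfg L → ℂ, Admissible L 0 G ∧ RQ L 0 Δ G ≤ RQ L (K1 L) Δ F - eps1 L

/-! ### Krein objects (memo 20 §277) for the `K₁` fibre -/

/-- Magnon dispersion `ε(k) = 2 − cos kₓ − cos k_y`. -/
noncomputable def epsT (k : Tor L) : ℝ :=
  2 - Real.cos (2 * Real.pi * k.1.val / L) - Real.cos (2 * Real.pi * k.2.val / L)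

/-- The three pole plane waves `(k₂,k₃) ∈ {(0,0), (K₁,0), (0,K₁)}` (free level `ε₁`). -/
def IsPoleK1 (k₂ k₃ : Tor L) : Bool :=
  (decide (k₂ = 0) && decide (k₃ = 0)) || (decide (k₂ = K1 L) && decide (k₃ = 0)) ||
    (decide (k₂ = 0) && decide (k₃ = K1 L))

/-- Free three-body energy denominators at `E = ε₁ + T` (positive off the poles for `T < 2ε₁`,
by `freeGap_K1`). -/
noncomputable def den (T : ℝ) (k₂ k₃ : Tor L) : ℝ :=
  epsT L (K1 L - k₂ - k₃) + epsT L k₂ + epsT L k₃ - eps1 L - T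

/-- Pole-removed free resolvent kernel `G_T((a,b),(a',b')) = V⁻² Σ' e^{ik₂(a−a') + ik₃(b−b')}/den`. -/
noncomputable def Gentry (T : ℝ) (c c' : Cfg L) : ℂ :=
  (1 / ((L : ℂ) ^ 2) ^ 2) *
    ∑ k₂ : Tor L, ∑ k₃ : Tor L,
      if IsPoleK1 L k₂ k₃ then 0
      else phase L k₂ (c.1 - c'.1) * phase L k₃ (c.2 - c'.2) / (den L T k₂ k₃ : ℂ)

/-- Index type of the Krein block matrix: hard-core configurations ⊕ shell configurations. -/
abbrev DS := {c : Cfg L // InD L c = true} ⊕ {c : Cfg L // InS L c = true}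

/-- Underlying configuration of a `D ⊕ S` index. -/
def cfgOf : DS L → Cfg L
  | Sum.inl d => d.1
  | Sum.inr s => s.1

/-- The Krein matrix `𝒩(T) = [[G_DD, G_DS], [G_SD, G_SS − (ΔW)⁻¹]]`. -/
noncomputable def Nmat (T Δ : ℝ) : Matrix (DS L) (DS L) ℂ := fun i j =>
  Gentry L T (cfgOf L i) (cfgOf L j) -
    (match i, j with
      | Sum.inr s, Sum.inr s' => if s = s' then (1 / (Δ * (Wcount L s.1 : ℝ)) : ℂ) else 0
      | _, _ => 0)

/-- The free symmetric pole state `v(a,b) = 1 + e^{iK₁·a} + e^{iK₁·b}` read on `D ⊕ S`. -/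
noncomputable def vpole : DS L → ℂ := fun i =>
  1 + phase L (K1 L) (cfgOf L i).1 + phase L (K1 L) (cfgOf L i).2

/-- The Krein functional `Φ(T) = ⟨v, 𝒩(T)⁻¹ v⟩ / (3V²)`. -/
noncomputable def Phi (T Δ : ℝ) : ℝ :=
  (star (vpole L) ⬝ᵥ (Nmat L T Δ)⁻¹.mulVec (vpole L)).re / (3 * ((L : ℝ) ^ 2) ^ 2)

/-- `E` is a Dirichlet eigenvalue of the symmetric `K` sector: an admissible `F` with
`(H F)(c) = E·F(c)` off the hard core. -/
def IsSectorEigenvalue (K : Tor L) (Δ E : ℝ) : Prop :=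
  ∃ F : Cfg L → ℂ, Admissible L K F ∧ ∀ c, InD L c = false → Happly L K Δ F c = (E : ℂ) * F c

/-- THEOREM KREIN-3 (port target): for `0 < T < 2ε₁` and `0 < Δ`, `ε₁ + T` is an eigenvalue of the
symmetric hard-core `K₁` sector iff `T` is a fixed point of `Φ`. -/
def KreinThree (Δ : ℝ) : Prop :=
  ∀ T : ℝ, 0 < T → T < 2 * eps1 L →
    (IsSectorEigenvalue L (K1 L) Δ (eps1 L + T) ↔ Phi L T Δ = T)

/-- CERTIFICATE LOGIC (port target): if no `K₁` level lies at or below `ε₁` (NOBIND), `Φ(T) > T`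
on `(0, T*]`, and some admissible `K = 0` function has Rayleigh quotient `≤ T*` (in the proof:
the Jastrow–Feynman product state, `T* = T⁺`), then `GM3Fibre`. -/
def CertLogic (Δ : ℝ) : Prop :=
  ∀ Tstar : ℝ, 0 < Tstar → Tstar < 2 * eps1 L →
    (∀ E : ℝ, IsSectorEigenvalue L (K1 L) Δ E → eps1 L < E) →
    (∀ T : ℝ, 0 < T → T ≤ Tstar → T < Phi L T Δ) →
    (∃ G : Cfg L → ℂ, Admissible L 0 G ∧ RQ L 0 Δ G ≤ Tstar) →
    GM3Fibre L Δ

end Summit.HubbardSuperconductivity.HubbardSuperconductivity.Theorems.AnisotropyChord.Transfer.Fibre3
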